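import Literature.MathematicalPhysics.QuantumFieldTheory.Balaban1983to89.HaarDensitySpecialUnitaryGlobal
import Literature.MathematicalPhysics.QuantumFieldTheory.Balaban1983to89.HaarExponentialChartGlobalIntegral

/-!
# `Balaban1983to89.HaarDensitySpecialUnitaryGlobalPi` — [Balaban1985UV3] (13) → (18) «∫dU′↾_{Ω₁} … dU′ = σ(A′)dA′» FOR
# `SU(N)`, GLOBALLY and over a FINITE BOND SET: Bochner form of the global formula, the one-bond coordinate measure
# `σ₀ · Π_{j,k} sinc((θ_j − θ_k)/2) dη|_Ω` on the alcove domain `Ω ⊆ 𝔰𝔲(N)`, the exponential chart MEASURE-PRESERVING from it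
# to the WHOLE Haar measure of `SU(N)`, and the bondwise chart `(A_b)_b ↦ (e^{A_b})_b` measure-preserving to `⊗_b dU(b)`

statement-level skeleton of published theorems with citation tags; proofs where landed; nothing here is a claim
about the Yang–Mills mass gap

Mega-formalization `lit-balaban` (HOME `run/shared/lean/pub/lit-balaban/`), unit `lit-balaban-p28` gen 14 (Phase-2 proof
seat; free-target protocol G.5-34(d), TAKING 2026-08-23T03:29Z).  File 7 (rider) of the target «[BrockerTomDieck1985] IV
Thm. (2.11)(ii) for `U(N)`, `SU(N)` + [Helgason2000] Thm. 1.14 (13) / [Balaban1985UV3] p. 260 GLOBALLY for `SU(N)`»: the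
`SU(N)` counterparts of gen 13's `HaarExponentialChartGlobalIntegral` (`U(N)` Bochner forms) and `HaarDensityUnitaryGlobalPi`
(`U(N)` measure-preserving / product forms), now on the alcove domain `Ω` of file 4 (`SpecialUnitaryAlcove.alcove`) with
file 6's `σ₀ = μ(SU(N))/∫_Ω |det jac| dη`.  These are the forms the corpus USES: Bałaban's bond variables are
`SU(N)`-valued ([Balaban1985UV3] (1), (13), (18)), integrated bondwise over a finite set of bonds.  SKELETON rows served
(SUPPORT cells only, no head change): B10.Eq21 / display E18 ([Balaban1985UV3] (18)/(21) pp. 260–261, owner r07),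
B13.Eq1.37 (r10), B12.Eq2.10–2.12 (r09/r20).

CITATION HEADER.  [Balaban1985UV3] T. Bałaban, *Ultraviolet stability of three-dimensional lattice pure gauge field
theories*, CMP **102** (1985) 255–275, p. 260: *«To write the integrals (13) in terms of the variables A′ we express the
Haar measure dU′ as dU′ = σ(A′)dA′ = σ₀ σ/σ₀ (A′)dA′, σ₀ = σ(0), where dA′ is the Lebesque measure on 𝔤, and σ(A′) is a
density which can be calculated explicitly for all classical groups»*, used in (18) p. 261 bond by bond over the finite
set of bonds of `Ω₁`.  [Helgason2000] S. Helgason, *Groups and Geometric Analysis*, Ch. I §1 Thm. 1.14 (13) p. 96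
*«∫_G f(g) dg = ∫_𝔤 f(exp X) det((1 − e^{−adX})/adX) dX»* (for `f` supported in the chart image; here `N₀ = Ω`, `exp Ω`
of full measure by files 3–5).

WHAT IS PROVED (theorems; definitions with bodies = the constant `sigma0 η μ : ℝ≥0` and the one-bond coordinate measure
`coordMeasure η μ` on `𝔰𝔲(N)`; 0 named facts, 0 sorry) — for every Haar measure `μ` on `SU(N)`, every additive Haar
measure `η` on `𝔰𝔲(N)`, every real Banach space `E`:
* §1 **`integral_haar_specialUnitaryGroup_eq_prod_sinc`**: `∫_{SU(N)} F dμ = σ₀ • ∫_Ω (Π_jΠ_k sinc((θ_j(A) − θ_k(A))/2)) •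
  F(e^A) dη(A)` for every a.e.-strongly measurable `F : SU(N) → E` (gen 13's `integral_haar_eq_of_null_det` BY NAME with
  file 4's injectivity and file 6's null complement; the tree's `det_jac_specialUnitaryLogChart_eq_prod_sinc`);
  `integral_haarProbability_specialUnitaryGroup_eq_prod_sinc` (`σ₀ = (∫_Ω ΠΠsinc dη)⁻¹`);
* §2 `lintegral_jacDensity_alcove_ne_zero_and_ne_top` (`0 < ∫_Ω |det jac| dη < ∞`), def **`sigma0`** (+ `coe_sigma0`,
  `sigma0_ne_zero`), def **`coordMeasure = σ₀ • |det jac| dη|_Ω`** (finite; `coordMeasure_eq_withDensity_prod_sinc`),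
  **`map_expChart_coordMeasure`: `Θ_*(coordMeasure) = μ`**, **`measurePreserving_expChart_specialUnitaryGroup`**;
* §3 **`measurePreserving_pi_expChart_specialUnitaryGroup`** (the bondwise chart `(A_b)_b ↦ (e^{A_b})_b` from
  `⊗_b coordMeasure` to `⊗_b μ`, finite bond set), **`lintegral_pi_haar_specialUnitaryGroup_eq`**,
  `pi_haar_specialUnitaryGroup_apply_eq`.

HONEST SCOPE.  (i) `SU(N)` only, every `N` (the `U(N)` forms are gen 13's); finite bond sets only (print's `Ω₁` is finite).
(ii) `σ₀` identified, not evaluated (see file 6).  (iii) `L²`-operator norm; `η` any additive Haar measure on `𝔰𝔲(N)`.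
(iv) Nothing of gen 8–13, files 1–6 or Mathlib is re-proved (`integral_haar_eq_of_null_det`, `measurePreserving_pi` BY
NAME).  Failed printed steps: none (HOME/GAPS.md unchanged).

## References
* T. Bałaban, *Ultraviolet stability of three-dimensional lattice pure gauge field theories*, Commun. Math. Phys.
  **102** (1985) 255–275, pp. 260–261, (13), (18). [Balaban1985UV3]
* S. Helgason, *Groups and Geometric Analysis*, AMS (2000), Ch. I §1 Thm. 1.14 p. 96. [Helgason2000]
-/

noncomputable section

open NormedSpace Set Function Filter Topology MeasureTheory Complex
open scoped ENNReal NNReal Matrix.Norms.L2Operator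

namespace Literature.MathematicalPhysics.QuantumFieldTheory.Balaban1983to89.HaarDensitySpecialUnitaryGlobal

open HaarExponentialChart HaarExponentialChart.IsChartRep SpecialUnitaryAlcove SpecialUnitaryPrincipalLog
open B13HaarSigmaJacobian (jac det_jac_real_nonneg)
open HaarDensityUnitaryChart (conjTranspose_eq_neg_of_mem_specialUnitaryLogChart jacDensity_specialUnitaryLogChart_eq
  det_jac_specialUnitaryLogChart_eq_prod_sinc)
open HaarDensityUnitaryExplicit (isHermitian_neg_I_smul)

variable {n : Type*} [Fintype n] [DecidableEq n] [Nonempty n]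
variable [MeasurableSpace (specialUnitaryLogChart n).lie] [BorelSpace (specialUnitaryLogChart n).lie]
  (η : Measure (specialUnitaryLogChart n).lie) [η.IsAddHaarMeasure]
  (μ : Measure (Matrix.specialUnitaryGroup n ℂ)) [μ.IsHaarMeasure]

/-! ## §1 Bochner forms of the global formula on `SU(N)` -/

section Bochner

variable {E : Type*} [NormedAddCommGroup E] [NormedSpace ℝ E]

/-- **HAAR MEASURE OF `SU(N)` IN EXPONENTIAL COORDINATES ON THE ALCOVE DOMAIN, Bochner form with the explicit density**:
for every Haar measure `μ` on `SU(N)`, every additive Haar measure `η` on `𝔰𝔲(N)` and every a.e.-strongly measurable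
`F : SU(N) → E`: `∫_{SU(N)} F dμ = σ₀ • ∫_Ω (Π_j Π_k sinc((θ_j(A) − θ_k(A))/2)) • F(e^A) dη(A)`,
`σ₀ = (μ(SU(N))/∫_Ω Π_j Π_k sinc((θ_j − θ_k)/2) dη).toReal`, `θ(A)` the eigenvalues of `−iA`.
[cite: Balaban1985UV3, p. 260] [cite: Helgason2000, Ch. I §1 Thm. 1.14 (13) p. 96] -/
theorem integral_haar_specialUnitaryGroup_eq_prod_sinc {F : Matrix.specialUnitaryGroup n ℂ → E}
    (hF : AEStronglyMeasurable F μ) :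
    ∫ g, F g ∂μ =
      (μ Set.univ / ∫⁻ A in alcove n, ENNReal.ofReal (∏ j, ∏ k,
          Real.sinc (((isHermitian_neg_I_smul (conjTranspose_eq_neg_of_mem_specialUnitaryLogChart A)).eigenvalues j -
            (isHermitian_neg_I_smul (conjTranspose_eq_neg_of_mem_specialUnitaryLogChart A)).eigenvalues k) / 2)) ∂η).toReal •
        ∫ A in alcove n, (∏ j, ∏ k,
            Real.sinc (((isHermitian_neg_I_smul (conjTranspose_eq_neg_of_mem_specialUnitaryLogChart A)).eigenvalues j -
              (isHermitian_neg_I_smul (conjTranspose_eq_neg_of_mem_specialUnitaryLogChart A)).eigenvalues k) / 2)) •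
          F ((isChartRep_specialUnitaryGroup (n := n)).expChart A) ∂η := by
  have h := (isChartRep_specialUnitaryGroup (n := n)).integral_haar_eq_of_null_det
    (lie_adStable_specialUnitaryGroup (n := n)) η μ IsChartRep.chartRadius_pos le_rfl measurableSet_alcove
    injOn_expChart_alcove (haar_compl_image_alcove_eq_zero μ) hF
  have hρ : ∀ A : (specialUnitaryLogChart n).lie, jacDensity (lie_adStable_specialUnitaryGroup (n := n)) A =
      ENNReal.ofReal (∏ j, ∏ k,
        Real.sinc (((isHermitian_neg_I_smul (conjTranspose_eq_neg_of_mem_specialUnitaryLogChart A)).eigenvalues j -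
          (isHermitian_neg_I_smul (conjTranspose_eq_neg_of_mem_specialUnitaryLogChart A)).eigenvalues k) / 2)) :=
    fun A => jacDensity_specialUnitaryLogChart_eq A
  simp only [hρ, det_jac_specialUnitaryLogChart_eq_prod_sinc] at h
  exact h

/-- **THE HAAR PROBABILITY MEASURE OF `SU(N)`, Bochner form**: `∫ F dU = σ₀ • ∫_Ω (Π_j Π_k sinc((θ_j − θ_k)/2)) •
F(e^A) dη(A)`, `σ₀ = σ(0) = (∫_Ω Πsinc dη).toReal⁻¹` — print's normalised one-bond measure `dU′` in the coordinates `A′`,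
for `SU(N)` on the alcove domain. [cite: Balaban1985UV3, p. 260] [cite: Helgason2000, Ch. I §1 Thm. 1.14 (13) p. 96] -/
theorem integral_haarProbability_specialUnitaryGroup_eq_prod_sinc [IsProbabilityMeasure μ]
    {F : Matrix.specialUnitaryGroup n ℂ → E} (hF : AEStronglyMeasurable F μ) :
    ∫ g, F g ∂μ =
      (∫⁻ A in alcove n, ENNReal.ofReal (∏ j, ∏ k,
          Real.sinc (((isHermitian_neg_I_smul (conjTranspose_eq_neg_of_mem_specialUnitaryLogChart A)).eigenvalues j -
            (isHermitian_neg_I_smul (conjTranspose_eq_neg_of_mem_specialUnitaryLogChart A)).eigenvalues k) / 2))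
              ∂η).toReal⁻¹ •
        ∫ A in alcove n, (∏ j, ∏ k,
            Real.sinc (((isHermitian_neg_I_smul (conjTranspose_eq_neg_of_mem_specialUnitaryLogChart A)).eigenvalues j -
              (isHermitian_neg_I_smul (conjTranspose_eq_neg_of_mem_specialUnitaryLogChart A)).eigenvalues k) / 2)) •
          F ((isChartRep_specialUnitaryGroup (n := n)).expChart A) ∂η := by
  rw [integral_haar_specialUnitaryGroup_eq_prod_sinc η μ hF, measure_univ, one_div, ENNReal.toReal_inv]

end Bochner

/-! ## §2 The one-bond coordinate measure `σ₀ · |det jac| · dη|_Ω` on `𝔰𝔲(N)` and the measure-preserving chart -/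

include μ in
/-- `0 < ∫_Ω |det jac| dη < ∞` (gen 13's `haar_univ_eq_of_null` for `SU(N)` on the alcove domain, read through any Haar
measure `μ`). [cite: Helgason2000, Ch. I §1 Thm. 1.14 (13) p. 96] -/
theorem lintegral_jacDensity_alcove_ne_zero_and_ne_top :
    ∫⁻ X in alcove n, jacDensity (lie_adStable_specialUnitaryGroup (n := n)) X ∂η ≠ 0 ∧
      ∫⁻ X in alcove n, jacDensity (lie_adStable_specialUnitaryGroup (n := n)) X ∂η ≠ ∞ :=
  ((isChartRep_specialUnitaryGroup (n := n)).haar_univ_eq_of_null (lie_adStable_specialUnitaryGroup (n := n)) η μ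
    IsChartRep.chartRadius_pos le_rfl measurableSet_alcove injOn_expChart_alcove
    (haar_compl_image_alcove_eq_zero μ)).2

/-- PRINT'S CONSTANT AS A NUMBER, for `SU(N)`: `σ₀ := (μ(SU(N)) / ∫_Ω |det jac| dη).toNNReal`.
[cite: Balaban1985UV3, p. 260] -/
def sigma0 (η : Measure (specialUnitaryLogChart n).lie) (μ : Measure (Matrix.specialUnitaryGroup n ℂ)) : ℝ≥0 :=
  (μ Set.univ / ∫⁻ X in alcove n, jacDensity (lie_adStable_specialUnitaryGroup (n := n)) X ∂η).toNNReal

/-- `(σ₀ : ℝ≥0∞) = μ(SU(N)) / ∫_Ω |det jac| dη` (the quotient is finite). [cite: Balaban1985UV3, p. 260] -/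
theorem coe_sigma0 :
    (sigma0 η μ : ℝ≥0∞) =
      μ Set.univ / ∫⁻ X in alcove n, jacDensity (lie_adStable_specialUnitaryGroup (n := n)) X ∂η :=
  ENNReal.coe_toNNReal (ENNReal.div_ne_top (isCompact_univ.measure_lt_top (μ := μ)).ne
    (lintegral_jacDensity_alcove_ne_zero_and_ne_top η μ).1)

/-- `σ₀ ≠ 0`. [cite: Balaban1985UV3, p. 260] -/
theorem sigma0_ne_zero : sigma0 η μ ≠ 0 := by
  intro h
  have h' := congrArg (fun x : ℝ≥0 => (x : ℝ≥0∞)) h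
  simp only [coe_sigma0, ENNReal.coe_zero] at h'
  rw [ENNReal.div_eq_zero_iff] at h'
  rcases h' with h' | h'
  · exact isOpen_univ.measure_ne_zero μ Set.univ_nonempty h'
  · exact (lintegral_jacDensity_alcove_ne_zero_and_ne_top η μ).2 h'

/-- THE ONE-BOND COORDINATE MEASURE `σ₀ · |det jac A| · dη(A)|_Ω` on `𝔰𝔲(N)` (print's `σ(A′)dA′ = σ₀ (σ/σ₀)(A′)dA′` on
the alcove domain). [cite: Balaban1985UV3, p. 260] -/
def coordMeasure (η : Measure (specialUnitaryLogChart n).lie) (μ : Measure (Matrix.specialUnitaryGroup n ℂ)) :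
    Measure (specialUnitaryLogChart n).lie :=
  sigma0 η μ • (η.restrict (alcove n)).withDensity (jacDensity (lie_adStable_specialUnitaryGroup (n := n)))

/-- The coordinate measure is finite (`∫_Ω |det jac| dη < ∞`). [cite: Balaban1985UV3, p. 260] -/
instance isFiniteMeasure_coordMeasure : IsFiniteMeasure (coordMeasure η μ) := by
  unfold coordMeasure
  haveI : IsFiniteMeasure ((η.restrict (alcove n)).withDensity
      (jacDensity (lie_adStable_specialUnitaryGroup (n := n)))) :=
    isFiniteMeasure_withDensity (lintegral_jacDensity_alcove_ne_zero_and_ne_top η μ).2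
  infer_instance

omit [BorelSpace (specialUnitaryLogChart n).lie] [η.IsAddHaarMeasure] [μ.IsHaarMeasure] in
/-- The density written explicitly: `coordMeasure = σ₀ • (Π_j Π_k sinc((θ_j − θ_k)/2)) dη|_Ω` (the tree's
`jacDensity_specialUnitaryLogChart_eq`). [cite: Balaban1985UV3, p. 260] -/
theorem coordMeasure_eq_withDensity_prod_sinc :
    coordMeasure η μ = sigma0 η μ • (η.restrict (alcove n)).withDensity (fun A => ENNReal.ofReal (∏ j, ∏ k,
      Real.sinc (((isHermitian_neg_I_smul (conjTranspose_eq_neg_of_mem_specialUnitaryLogChart A)).eigenvalues j -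
        (isHermitian_neg_I_smul (conjTranspose_eq_neg_of_mem_specialUnitaryLogChart A)).eigenvalues k) / 2))) := by
  unfold coordMeasure
  congr 2
  funext A
  exact jacDensity_specialUnitaryLogChart_eq A

/-- **`Θ_*(σ₀ · |det jac| · dη|_Ω) = μ`**: the push-forward of the coordinate measure under the exponential chart IS the
(whole) Haar measure of `SU(N)`. [cite: Balaban1985UV3, p. 260] [cite: Helgason2000, Ch. I §1 Thm. 1.14 (13) p. 96] -/
theorem map_expChart_coordMeasure :
    (coordMeasure η μ).map (isChartRep_specialUnitaryGroup (n := n)).expChart = μ := by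
  have hμ := haar_specialUnitaryGroup_eq_smul_chartMeasureOn η μ IsChartRep.chartRadius_pos le_rfl
  rw [windowConst_specialUnitaryGroup_eq η μ IsChartRep.chartRadius_pos le_rfl, ← coe_sigma0] at hμ
  conv_rhs => rw [hμ]
  rw [coordMeasure, Measure.map_smul, ENNReal.smul_def]
  rfl

/-- **THE EXPONENTIAL CHART OF `SU(N)` IS MEASURE-PRESERVING from `(𝔰𝔲(N), σ₀·|det jac|·dη|_Ω)` to `(SU(N), μ)`** —
«dU′ = σ(A′)dA′» as a global statement on the alcove domain.
[cite: Balaban1985UV3, p. 260] [cite: Helgason2000, Ch. I §1 Thm. 1.14 (13) p. 96] -/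
theorem measurePreserving_expChart_specialUnitaryGroup :
    MeasurePreserving (isChartRep_specialUnitaryGroup (n := n)).expChart (coordMeasure η μ) μ :=
  ⟨(isChartRep_specialUnitaryGroup (n := n)).measurable_expChart, map_expChart_coordMeasure η μ⟩

/-! ## §3 (13) → (18) over a finite bond set: the product Haar measure of `SU(N)^β` in canonical coordinates -/

variable {β : Type*} [Fintype β]

/-- **«∫dU′↾_{Ω₁}» → «∫dA′↾_{Ω₁} Π_b σ(A′(b))dA′(b)» FOR `SU(N)`, GLOBALLY**: the bondwise chart `(A_b)_b ↦ (e^{A_b})_b`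
is MEASURE-PRESERVING from `⊗_b (σ₀·|det jac|·dη|_Ω)` to the product Haar measure `⊗_b μ` on `SU(N)^β` (Mathlib
`measurePreserving_pi`). [cite: Balaban1985UV3, p. 260] [cite: Helgason2000, Ch. I §1 Thm. 1.14 (13) p. 96] -/
theorem measurePreserving_pi_expChart_specialUnitaryGroup :
    MeasurePreserving
      (fun A : β → (specialUnitaryLogChart n).lie => fun b => (isChartRep_specialUnitaryGroup (n := n)).expChart (A b))
      (Measure.pi fun _ : β => coordMeasure η μ) (Measure.pi fun _ : β => μ) :=
  measurePreserving_pi (fun _ : β => coordMeasure η μ) (fun _ : β => μ)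
    fun _ => measurePreserving_expChart_specialUnitaryGroup η μ

/-- **THE PRODUCT HAAR INTEGRAL OF `SU(N)^β` IN CANONICAL COORDINATES**: for every measurable `F ≥ 0` on `SU(N)^β`,
`∫ F d(⊗_b μ) = ∫ F((e^{A_b})_b) d(⊗_b σ₀·|det jac A_b|·dη(A_b)|_Ω)`.
[cite: Balaban1985UV3, p. 260] [cite: Helgason2000, Ch. I §1 Thm. 1.14 (13) p. 96] -/
theorem lintegral_pi_haar_specialUnitaryGroup_eq {F : (β → Matrix.specialUnitaryGroup n ℂ) → ℝ≥0∞}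
    (hF : Measurable F) :
    ∫⁻ U, F U ∂(Measure.pi fun _ : β => μ) =
      ∫⁻ A, F (fun b => (isChartRep_specialUnitaryGroup (n := n)).expChart (A b))
        ∂(Measure.pi fun _ : β => coordMeasure η μ) := by
  rw [← (measurePreserving_pi_expChart_specialUnitaryGroup (β := β) η μ).map_eq,
    lintegral_map hF (measurePreserving_pi_expChart_specialUnitaryGroup (β := β) η μ).measurable]

/-- The same for the measure of Borel subsets of `SU(N)^β`: `(⊗_b μ)(B) = (⊗_b coordMeasure)({A : (e^{A_b})_b ∈ B})`.
[cite: Balaban1985UV3, p. 260] -/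
theorem pi_haar_specialUnitaryGroup_apply_eq {B : Set (β → Matrix.specialUnitaryGroup n ℂ)} (hB : MeasurableSet B) :
    (Measure.pi fun _ : β => μ) B =
      (Measure.pi fun _ : β => coordMeasure η μ)
        ((fun A : β → (specialUnitaryLogChart n).lie => fun b =>
          (isChartRep_specialUnitaryGroup (n := n)).expChart (A b)) ⁻¹' B) := by
  rw [← (measurePreserving_pi_expChart_specialUnitaryGroup (β := β) η μ).map_eq,
    Measure.map_apply (measurePreserving_pi_expChart_specialUnitaryGroup (β := β) η μ).measurable hB]

end Literature.MathematicalPhysics.QuantumFieldTheory.Balaban1983to89.HaarDensitySpecialUnitaryGlobal
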